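import Literature.AlgebraicGeometry.HodgeTheory.CyclicReflectionOfLocalisation
import Literature.AlgebraicGeometry.HodgeTheory.CyclicReflectionSystemOfMeridians
import Mathlib.RingTheory.AdjoinRoot
import Mathlib.RingTheory.Polynomial.Cyclotomic.Roots
import HarnessLib

/-!
# Recognising the cyclic reflection from `τ`-FREE local monodromy data
# (Carlson–Toledo 1999 §6: "the local monodromy transformation is `T = σ₀ ⊗ (−1) ⊗ ⋯ ⊗ (−1)`" becomes a theorem
# about any automorphism commuting with the covering transformation)

Family `hodge`, layer `Literature/AlgebraicGeometry/HodgeTheory`; theorems only (no definition, no named fact);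
sequel of `CyclicReflectionOfLocalisation` (prover-Ax g8) and `CyclicReflectionSystemSpanRank` (prover-Bx g7).

For the universal family of `p`-cyclic covers `X_F = V₊(x₃^p − f) → ℙ²` of the plane, Carlson–Toledo identify
the monodromy `T` of a meridian of the discriminant on the `(p−1)`-dimensional vanishing space `V` of the
`A_{p−1}`-degeneration `y^p = x₁² + x₂²` with the COVERING TRANSFORMATION `σ`: "`T = σ₀ ⊗ (−1) ⊗ (−1)`" (§6).
This file proves that this identification is AUTOMATIC up to a unit power: it follows by pure linear algebra from
the `σ`-free part of the local datum, the commutation of the monodromy with the covering group and the size of the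
invariant line. Precisely (`sum_pow_eq_zero_and_exists_pow_of_commute`): let `p` be prime, `τ` an automorphism
of a finite-dimensional `ℚ`-space `H` with `τ^p = 1` whose fixed space has dimension `< p − 1` (for the cyclic
covers: `H²(X_F; ℚ)^σ = H²(ℙ²; ℚ)` is a line and `p ≥ 3`), `T` an automorphism COMMUTING with `τ`, and
`W ≠ 0` a subspace with `T x − x ∈ W` for all `x`, `Σ_{i<p} T^i = 0` on `W` and `dim W ≤ p − 1` (the local
monodromy datum of the `A_{p−1}` surface degeneration: `(T − 1)H² ⊆ V`, `T|_V` of order `p` without fixed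
vector, `dim V = μ = p − 1`). THEN `W = (T − 1)H` is `τ`-stable, `Σ_{i<p} τ^i = 0` on `W`, and
`T|_W = τ^j|_W` for a unit `j (mod p)`.

Proof: `W₀ := (T−1)H ⊆ W` is `T`- and `τ`-stable; a `τ`-fixed `w ∈ W₀ ∖ 0` would span under `T` a
`(p−1)`-dimensional subspace (`Φ_p(T) w = 0`, `Φ_p` irreducible; `finrank_cyclicSpan_of_sum_pow_apply_eq_zero`)
of `τ`-fixed vectors — too many; so `W₀` has no `τ`-invariants, `Σ_{i<p} τ^i = 0` on it, hence `W₀` is a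
`ℚ(ζ_p)`-line `ℚ[τ]w₀ = W₀ = W`; `T|_W` commutes with `τ`, so it is multiplication by some `q(ζ_p)`, a root
of `Φ_p` in `ℚ(ζ_p) = ℚ[x]/(Φ_p)` (`AdjoinRoot`), i.e. a power `ζ_p^j`, `0 < j < p`.

Consequence for the consumer (`exists_pow_isCyclicReflection_of_commute`): if moreover `T` is an isometry of a
non-degenerate symmetric form `B` (the cup product), then for `k = j⁻¹ (mod p)` the power `T^k` is the CYCLIC
REFLECTION `IsCyclicReflection B τ δ (T^k)` along `ℚ[τ]δ = W = (T − 1)H` of `CyclicCoverReflectionMonodromy`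
(all clauses of the cited meridian fact, via `exists_cyclicReflection_data_of_localisation`), and `T` is a power
of `T^k` (`T^p = 1`). So the cited Picard–Lefschetz input of crux K1 of the route
`Summits/HodgeConjecture/HodgeConjecture/Theses/CyclicUnitaryPowers.lean` can be cut down to the `σ`-free local
monodromy of an `A_{p−1}` degeneration (Milnor, Brieskorn), the deck identification being this theorem.

Everything is proved (Mathlib + the two tree files above). Written by the prover seat `hodge-nonav-prover-Ax` (g9).

## References

* [CarlsonToledo1999] J. A. Carlson, D. Toledo, Discriminant complements and kernels of monodromy
  representations, Duke Math. J. 97 (1999); arXiv alg-geom/9708002, §6 (held text p0013–p0014): the vanishing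
  space of (kdoublept) is `(k−1)`-dimensional, `T = σ₀ ⊗ (−1) ⊗ ⋯ ⊗ (−1)`, Proposition.
* [Milnor1968] J. Milnor, Singular points of complex hypersurfaces, Ann. of Math. Studies 61 (1968), Thm. 9.1
  (the monodromy of `z₀^{a₀} + ⋯ + z_n^{a_n}`; characteristic polynomial).
* [Washington1997] L. C. Washington, Introduction to Cyclotomic Fields, GTM 83, Ch. 2 (`Φ_p` irreducible,
  roots of unity in `ℚ(ζ_p)`).
-/

noncomputable section

open Polynomial Module

namespace Literature.AlgebraicGeometry.HodgeTheory

section Algebra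

variable {V : Type*} [AddCommGroup V] [Module ℚ V]

/-- `((τ : End) ^ i) x = (τ ^ i) x`. [cite: CarlsonToledo1999, §6 (held text p0013)] -/
private theorem end_pow_apply' (τ : V ≃ₗ[ℚ] V) (i : ℕ) (x : V) :
    ((τ : V →ₗ[ℚ] V) ^ i) x = (τ ^ i) x := by
  rw [Module.End.coe_pow, LinearEquiv.coe_pow]
  rfl

/-- `1 x = x` in the automorphism group `V ≃ₗ[ℚ] V`. [cite: CarlsonToledo1999, §6 (held text p0013)] -/
private theorem linearEquiv_one_apply (x : V) : (1 : V ≃ₗ[ℚ] V) x = x := rfl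

/-- Commuting automorphisms: `T` commutes with every power of `τ`. [cite: CarlsonToledo1999, §6 (held text p0013)] -/
theorem apply_pow_apply_of_commute (T τ : V ≃ₗ[ℚ] V) (hcomm : ∀ x, T (τ x) = τ (T x)) (i : ℕ) (x : V) :
    T ((τ ^ i) x) = (τ ^ i) (T x) := by
  induction i generalizing x with
  | zero => rw [pow_zero, linearEquiv_one_apply, linearEquiv_one_apply]
  | succ i ih => rw [pow_succ, LinearEquiv.mul_apply, LinearEquiv.mul_apply, ih, hcomm]

/-- Commuting automorphisms: `T` commutes with every polynomial in `τ`. [cite: CarlsonToledo1999, §6 (held text p0013)] -/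
theorem apply_aeval_apply_of_commute (T τ : V ≃ₗ[ℚ] V) (hcomm : ∀ x, T (τ x) = τ (T x)) (g : ℚ[X]) (x : V) :
    T (Polynomial.aeval (τ : V →ₗ[ℚ] V) g x) = Polynomial.aeval (τ : V →ₗ[ℚ] V) g (T x) := by
  rw [Polynomial.aeval_eq_sum_range, LinearMap.sum_apply, LinearMap.sum_apply, map_sum]
  refine Finset.sum_congr rfl fun i _ => ?_
  rw [LinearMap.smul_apply, LinearMap.smul_apply, map_smul, end_pow_apply', end_pow_apply',
    apply_pow_apply_of_commute T τ hcomm]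

/-- A subspace containing all `T x − x` is stable under every power of `T`, and `T^n x − x` lies in it.
[cite: CarlsonToledo1999, §6 (held text p0013)] -/
theorem pow_apply_sub_mem_of_sub_mem (T : V ≃ₗ[ℚ] V) (W : Submodule ℚ V) (hrange : ∀ x, T x - x ∈ W)
    (n : ℕ) (x : V) : (T ^ n) x - x ∈ W := by
  induction n generalizing x with
  | zero => rw [pow_zero, linearEquiv_one_apply, sub_self]; exact W.zero_mem
  | succ n ih =>
    have h : (T ^ (n + 1)) x - x = ((T ^ n) (T x) - T x) + (T x - x) := by
      rw [pow_succ, LinearEquiv.mul_apply]; abel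
    rw [h]
    exact W.add_mem (ih (T x)) (hrange x)

/-- Powers of a `B`-isometry are `B`-isometries. [cite: CarlsonToledo1999, §6 (held text p0013)] -/
theorem isometry_pow {B : LinearMap.BilinForm ℚ V} (T : V ≃ₗ[ℚ] V) (hT : ∀ x y, B (T x) (T y) = B x y)
    (n : ℕ) (x y : V) : B ((T ^ n) x) ((T ^ n) y) = B x y := by
  induction n generalizing x y with
  | zero => rw [pow_zero, linearEquiv_one_apply, linearEquiv_one_apply]
  | succ n ih => rw [pow_succ, LinearEquiv.mul_apply, LinearEquiv.mul_apply, ih, hT]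

/-- Polynomials in `τ` applied to `δ` vanish exactly on the multiples of `Φ_p`, when `p` is prime, `δ ≠ 0` and
`Σ_{i<p} τ^i δ = 0` (the annihilator of `δ` is the maximal ideal `(Φ_p)`). [cite: Washington1997, Ch. 2] -/
theorem aeval_apply_eq_zero_iff_cyclotomic_dvd {p : ℕ} (hp : p.Prime) (τ : V ≃ₗ[ℚ] V) {δ : V} (hδ : δ ≠ 0)
    (h : ∑ i ∈ Finset.range p, (τ ^ i) δ = 0) (g : ℚ[X]) :
    Polynomial.aeval (τ : V →ₗ[ℚ] V) g δ = 0 ↔ Polynomial.cyclotomic p ℚ ∣ g := by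
  have hΨ : Polynomial.aeval (τ : V →ₗ[ℚ] V) (Polynomial.cyclotomic p ℚ) δ = 0 := by
    rw [aeval_cyclotomic_apply hp, h]
  constructor
  · intro hg
    by_contra hndvd
    obtain ⟨a, b, hab⟩ := (Polynomial.cyclotomic.irreducible_rat hp.pos).coprime_iff_not_dvd.mpr hndvd
    have h1 : Polynomial.aeval (τ : V →ₗ[ℚ] V) (a * Polynomial.cyclotomic p ℚ + b * g) δ = δ := by
      rw [hab, map_one, Module.End.one_apply]
    rw [map_add, map_mul, map_mul, LinearMap.add_apply, Module.End.mul_apply, Module.End.mul_apply, hΨ, hg,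
      map_zero, map_zero, add_zero] at h1
    exact hδ h1.symm
  · rintro ⟨c, rfl⟩
    rw [mul_comm, map_mul, Module.End.mul_apply, hΨ, map_zero]

/-- Every vector of `ℚ[τ]δ` is `g(τ)δ` for a polynomial `g`. [cite: CarlsonToledo1999, §6 (held text p0013)] -/
theorem exists_aeval_apply_eq_of_mem_cyclicSpan (τ : V ≃ₗ[ℚ] V) (δ : V) {x : V} (hx : x ∈ cyclicSpan τ δ) :
    ∃ g : ℚ[X], Polynomial.aeval (τ : V →ₗ[ℚ] V) g δ = x := by
  induction hx using Submodule.span_induction with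
  | mem y hy =>
    obtain ⟨i, rfl⟩ := hy
    exact ⟨X ^ i, by rw [map_pow, Polynomial.aeval_X, end_pow_apply']⟩
  | zero => exact ⟨0, by rw [map_zero, LinearMap.zero_apply]⟩
  | add y z _ _ hy hz =>
    obtain ⟨g, rfl⟩ := hy
    obtain ⟨g', rfl⟩ := hz
    exact ⟨g + g', by rw [map_add, LinearMap.add_apply]⟩
  | smul c y _ hy =>
    obtain ⟨g, rfl⟩ := hy
    exact ⟨c • g, by rw [map_smul, LinearMap.smul_apply]⟩

/-- **Roots of `Φ_p` in `ℚ(ζ_p)` are powers of `ζ_p`**, polynomial form: if `Φ_p` divides `Σ_{i<p} q^i = Φ_p(q)`,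
then `q ≡ x^j (mod Φ_p)` for some `0 < j < p`. [cite: Washington1997, Ch. 2] -/
theorem exists_cyclotomic_dvd_sub_X_pow {p : ℕ} (hp : p.Prime) {q : ℚ[X]}
    (hq : Polynomial.cyclotomic p ℚ ∣ ∑ i ∈ Finset.range p, q ^ i) :
    ∃ j, 0 < j ∧ j < p ∧ Polynomial.cyclotomic p ℚ ∣ q - X ^ j := by
  classical
  haveI := Fact.mk hp
  haveI : NeZero p := ⟨hp.ne_zero⟩
  set P : ℚ[X] := Polynomial.cyclotomic p ℚ with hP
  haveI hirr : Fact (Irreducible P) := ⟨by rw [hP]; exact Polynomial.cyclotomic.irreducible_rat hp.pos⟩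
  haveI : CharZero (AdjoinRoot P) :=
    charZero_of_injective_algebraMap (algebraMap ℚ (AdjoinRoot P)).injective
  -- `ζ := root P` and `α := q(ζ)` are primitive `p`-th roots of unity in the field `ℚ[x]/(Φ_p)`
  have hζ : IsPrimitiveRoot (AdjoinRoot.root P) p := by
    rw [← Polynomial.isRoot_cyclotomic_iff_charZero hp.pos, ← Polynomial.map_cyclotomic p (AdjoinRoot.of P),
      Polynomial.IsRoot.def, Polynomial.eval_map, ← hP, AdjoinRoot.eval₂_root]
  have hα : IsPrimitiveRoot (AdjoinRoot.mk P q) p := by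
    rw [← Polynomial.isRoot_cyclotomic_iff_charZero hp.pos, Polynomial.IsRoot.def, Polynomial.cyclotomic_prime,
      Polynomial.eval_finsetSum]
    have h0 : AdjoinRoot.mk P (∑ i ∈ Finset.range p, q ^ i) = 0 := AdjoinRoot.mk_eq_zero.mpr hq
    rw [map_sum] at h0
    rw [← h0]
    refine Finset.sum_congr rfl fun i _ => ?_
    rw [Polynomial.eval_pow, Polynomial.eval_X, map_pow]
  obtain ⟨j, hjp, hj⟩ := hζ.eq_pow_of_pow_eq_one hα.pow_eq_one
  have hj0 : 0 < j := by
    rcases Nat.eq_zero_or_pos j with rfl | h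
    · exact absurd (by rw [← hj, pow_zero]) (hα.ne_one hp.one_lt)
    · exact h
  refine ⟨j, hj0, hjp, ?_⟩
  rw [← AdjoinRoot.mk_eq_zero, map_sub, map_pow, AdjoinRoot.mk_X, hj, sub_self]

/-- **Recognition theorem.** Let `p` be prime, `τ` an automorphism of the finite-dimensional `ℚ`-space `V` with
`τ^p = 1` and `dim V^τ < p − 1`, `T` an automorphism commuting with `τ`, `W ≠ 0` a subspace with `T x − x ∈ W`
for all `x`, `Σ_{i<p} T^i = 0` on `W` and `dim W ≤ p − 1`. Then `W` is `τ`-stable, `Σ_{i<p} τ^i = 0` on `W`,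
`W = (T − 1)V`, and `T|_W = τ^j|_W` for some `0 < j < p`: the local monodromy of the `A_{p−1}`-degeneration IS
a unit power of the covering transformation on the vanishing space ("`T = σ₀ ⊗ (−1) ⊗ (−1)`"), with no further
geometric input. [cite: CarlsonToledo1999, §6 (kdoublept) and Proposition (held text p0013–p0014)] [cite: Washington1997, Ch. 2] -/
theorem sum_pow_eq_zero_and_exists_pow_of_commute [Module.Finite ℚ V] {p : ℕ} (hp : p.Prime)
    (T τ : V ≃ₗ[ℚ] V) (hcomm : ∀ x, T (τ x) = τ (T x)) (hτp : τ ^ p = 1)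
    (hfix : Module.finrank ℚ (Module.End.eigenspace (τ : V →ₗ[ℚ] V) 1) < p - 1)
    (W : Submodule ℚ V) (hrange : ∀ x, T x - x ∈ W)
    (hsum : ∀ w ∈ W, ∑ i ∈ Finset.range p, (T ^ i) w = 0)
    (hdim : Module.finrank ℚ W ≤ p - 1) (hW0 : W ≠ ⊥) :
    (∀ w ∈ W, τ w ∈ W) ∧
    (∀ w ∈ W, ∑ i ∈ Finset.range p, (τ ^ i) w = 0) ∧
    (∀ w ∈ W, ∃ x, T x - x = w) ∧
    ∃ j, 0 < j ∧ j < p ∧ ∀ w ∈ W, T w = (τ ^ j) w := by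
  classical
  have hp0 : p ≠ 0 := hp.ne_zero
  have hp2 : 2 ≤ p := hp.two_le
  have hcomm' : ∀ x, τ (T x) = T (τ x) := fun x => (hcomm x).symm
  -- Step 1: `W₀ := (T − 1)V ⊆ W` is `T`- and `τ`-stable
  set W₀ : Submodule ℚ V := LinearMap.range ((T : V →ₗ[ℚ] V) - LinearMap.id) with hW₀def
  have hW₀mem : ∀ x, T x - x ∈ W₀ := fun x => ⟨x, rfl⟩
  have hW₀le : W₀ ≤ W := by
    rintro _ ⟨x, rfl⟩
    exact hrange x
  have hτW₀ : ∀ w ∈ W₀, τ w ∈ W₀ := by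
    rintro _ ⟨x, rfl⟩
    refine ⟨τ x, ?_⟩
    change T (τ x) - τ x = τ (T x - x)
    rw [map_sub, hcomm]
  have hτiW₀ : ∀ (i : ℕ) (w : V), w ∈ W₀ → (τ ^ i) w ∈ W₀ := by
    intro i
    induction i with
    | zero => intro w hw; rwa [pow_zero, linearEquiv_one_apply]
    | succ i ih => intro w hw; rw [pow_succ', LinearEquiv.mul_apply]; exact hτW₀ _ (ih w hw)
  -- Step 2: no `τ`-fixed vector in `W₀` (else `T` spans `p − 1` independent `τ`-fixed vectors)
  have hnofix : ∀ w ∈ W₀, τ w = w → w = 0 := by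
    intro w hw hτw
    by_contra hw0
    have hle : cyclicSpan T w ≤ Module.End.eigenspace (τ : V →ₗ[ℚ] V) 1 := by
      rw [cyclicSpan_def, Submodule.span_le]
      rintro _ ⟨i, rfl⟩
      rw [SetLike.mem_coe, Module.End.mem_eigenspace_iff, one_smul]
      change τ ((T ^ i) w) = (T ^ i) w
      rw [apply_pow_apply_of_commute τ T hcomm' i w, hτw]
    have h1 := finrank_cyclicSpan_of_sum_pow_apply_eq_zero hp T hw0 (hsum w (hW₀le hw))
    have h2 := Submodule.finrank_mono hle
    omega
  -- Step 3: `Σ_{i<p} τ^i = 0` on `W₀`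
  have hsumτ₀ : ∀ w ∈ W₀, ∑ i ∈ Finset.range p, (τ ^ i) w = 0 := by
    intro w hw
    refine hnofix _ (W₀.sum_mem fun i _ => hτiW₀ i w hw) ?_
    rw [map_sum]
    have hshift : ∀ i ∈ Finset.range p, τ ((τ ^ i) w) = (τ ^ (i + 1)) w := fun i _ => by
      rw [pow_succ', LinearEquiv.mul_apply]
    rw [Finset.sum_congr rfl hshift]
    have key : ∑ i ∈ Finset.range (p + 1), (τ ^ i) w = ∑ i ∈ Finset.range p, (τ ^ (i + 1)) w + (τ ^ 0) w :=
      Finset.sum_range_succ' _ _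
    rw [Finset.sum_range_succ, hτp, pow_zero] at key
    exact (add_right_cancel key).symm
  -- Step 4: `W₀ ≠ 0`, so `W₀` contains a `ℚ(ζ_p)`-line and `W₀ = W = ℚ[τ]w₀`
  have hW₀0 : W₀ ≠ ⊥ := by
    intro h0
    have hT1 : ∀ x, T x = x := fun x => by
      have hx : T x - x ∈ W₀ := hW₀mem x
      rw [h0, Submodule.mem_bot, sub_eq_zero] at hx
      exact hx
    obtain ⟨w, hwW, hw0⟩ := (Submodule.ne_bot_iff W).1 hW0
    have hs := hsum w hwW
    rw [sum_pow_apply_of_apply_eq_self T p (hT1 w)] at hs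
    exact hw0 ((smul_eq_zero.mp hs).resolve_left (Nat.cast_ne_zero.mpr hp0))
  obtain ⟨w₀, hw₀W₀, hw₀0⟩ := (Submodule.ne_bot_iff W₀).1 hW₀0
  have hcycle : cyclicSpan τ w₀ ≤ W₀ := by
    rw [cyclicSpan_def, Submodule.span_le]
    rintro _ ⟨i, rfl⟩
    exact hτiW₀ i w₀ hw₀W₀
  have hfr : Module.finrank ℚ (cyclicSpan τ w₀) = p - 1 :=
    finrank_cyclicSpan_of_sum_pow_apply_eq_zero hp τ hw₀0 (hsumτ₀ w₀ hw₀W₀)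
  have hW₀W : W₀ = W := by
    refine Submodule.eq_of_le_of_finrank_le hW₀le ?_
    calc Module.finrank ℚ W ≤ p - 1 := hdim
      _ = Module.finrank ℚ (cyclicSpan τ w₀) := hfr.symm
      _ ≤ Module.finrank ℚ W₀ := Submodule.finrank_mono hcycle
  have hCW : cyclicSpan τ w₀ = W :=
    Submodule.eq_of_le_of_finrank_le (hcycle.trans hW₀le) (by rw [hfr]; exact hdim)
  have hWW₀ : ∀ w ∈ W, w ∈ W₀ := fun w hw => by rwa [hW₀W]
  have hτW : ∀ w ∈ W, τ w ∈ W := fun w hw => hW₀le (hτW₀ w (hWW₀ w hw))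
  have hTW : ∀ w ∈ W, T w ∈ W := fun w hw => LinearEquiv.mem_of_sub_mem T W hrange hw
  have hsumτ : ∀ w ∈ W, ∑ i ∈ Finset.range p, (τ ^ i) w = 0 := fun w hw => hsumτ₀ w (hWW₀ w hw)
  refine ⟨hτW, hsumτ, fun w hw => ?_, ?_⟩
  · obtain ⟨x, hx⟩ := hWW₀ w hw
    exact ⟨x, hx⟩
  -- Step 5: `T|_W` is a polynomial `q(τ)` (it commutes with `τ` on the line `ℚ[τ]w₀ = W`)
  have hpoly : ∀ w ∈ W, ∃ g : ℚ[X], Polynomial.aeval (τ : V →ₗ[ℚ] V) g w₀ = w := fun w hw =>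
    exists_aeval_apply_eq_of_mem_cyclicSpan τ w₀ (by rwa [hCW])
  have hw₀W : w₀ ∈ W := hW₀le hw₀W₀
  obtain ⟨q, hq⟩ := hpoly (T w₀) (hTW w₀ hw₀W)
  have hTq : ∀ g : ℚ[X], T (Polynomial.aeval (τ : V →ₗ[ℚ] V) g w₀) =
      Polynomial.aeval (τ : V →ₗ[ℚ] V) (g * q) w₀ := fun g => by
    rw [apply_aeval_apply_of_commute T τ hcomm, ← hq, map_mul, Module.End.mul_apply]
  -- `Φ_p(q)(τ) w₀ = Σ_{i<p} T^i w₀ = 0`, so `Φ_p ∣ Φ_p(q)` and `q ≡ x^j`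
  have hTi : ∀ i : ℕ, (T ^ i) w₀ = Polynomial.aeval (τ : V →ₗ[ℚ] V) (q ^ i) w₀ := fun i => by
    induction i with
    | zero => rw [pow_zero, pow_zero, linearEquiv_one_apply, map_one, Module.End.one_apply]
    | succ i ih => rw [pow_succ', LinearEquiv.mul_apply, ih, hTq, pow_succ]
  have hker := aeval_apply_eq_zero_iff_cyclotomic_dvd hp τ hw₀0 (hsumτ w₀ hw₀W)
  have hdvd : Polynomial.cyclotomic p ℚ ∣ ∑ i ∈ Finset.range p, q ^ i := by
    rw [← hker, map_sum, LinearMap.sum_apply, ← hsum w₀ hw₀W]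
    exact Finset.sum_congr rfl fun i _ => (hTi i).symm
  obtain ⟨j, hj0, hjp, hjq⟩ := exists_cyclotomic_dvd_sub_X_pow hp hdvd
  refine ⟨j, hj0, hjp, fun w hw => ?_⟩
  obtain ⟨g, rfl⟩ := hpoly w hw
  have hzero : Polynomial.aeval (τ : V →ₗ[ℚ] V) (g * (q - X ^ j)) w₀ = 0 :=
    (hker _).mpr (dvd_mul_of_dvd_right hjq g)
  have hsplit : g * q = X ^ j * g + g * (q - X ^ j) := by ring
  rw [hTq, hsplit, map_add, LinearMap.add_apply, hzero, add_zero, map_mul, Module.End.mul_apply, map_pow,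
    Polynomial.aeval_X, end_pow_apply']

/-- **A power of the monodromy is the cyclic reflection** (consumer package). Under the hypotheses of
`sum_pow_eq_zero_and_exists_pow_of_commute`, if moreover `B` is a non-degenerate symmetric form and `T` a
`B`-isometry, then some power `T^k` is the cyclic reflection `IsCyclicReflection B τ δ (T^k)` along a vanishing
space `ℚ[τ]δ = W = (T − 1)V` with `δ ≠ 0`, `Σ_{i<p} τ^i δ = 0`, `dim ℚ[τ]δ = p − 1`, `B|_{ℚ[τ]δ}` non-degenerate,
and `T` is itself a power of `T^k` — all clauses Carlson–Toledo's §6 Proposition asserts for the meridian monodromy,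
for `T^k` in place of `T`. [cite: CarlsonToledo1999, §6 Proposition (held text p0013–p0014)] [cite: Washington1997, Ch. 2] -/
theorem exists_pow_isCyclicReflection_of_commute [Module.Finite ℚ V] {p : ℕ} (hp : p.Prime)
    (B : LinearMap.BilinForm ℚ V) (hB : B.Nondegenerate) (hBs : B.IsSymm)
    (T τ : V ≃ₗ[ℚ] V) (hT : ∀ x y, B (T x) (T y) = B x y)
    (hcomm : ∀ x, T (τ x) = τ (T x)) (hτp : τ ^ p = 1)
    (hfix : Module.finrank ℚ (Module.End.eigenspace (τ : V →ₗ[ℚ] V) 1) < p - 1)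
    (W : Submodule ℚ V) (hrange : ∀ x, T x - x ∈ W)
    (hsum : ∀ w ∈ W, ∑ i ∈ Finset.range p, (T ^ i) w = 0)
    (hdim : Module.finrank ℚ W ≤ p - 1) (hW0 : W ≠ ⊥) :
    ∃ (k : ℕ) (δ : V), δ ≠ 0 ∧ (∑ i ∈ Finset.range p, (τ ^ i) δ) = 0 ∧
      Module.finrank ℚ (cyclicSpan τ δ) = p - 1 ∧
      (∀ x ∈ cyclicSpan τ δ, (∀ y ∈ cyclicSpan τ δ, B x y = 0) → x = 0) ∧
      IsCyclicReflection B τ δ (T ^ k) ∧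
      T ∈ Subgroup.zpowers (T ^ k) ∧
      cyclicSpan τ δ = W ∧
      LinearMap.range ((T : V →ₗ[ℚ] V) - LinearMap.id) = W := by
  classical
  haveI := Fact.mk hp
  have hp0 : p ≠ 0 := hp.ne_zero
  obtain ⟨hτW, hsumτ, hrangeW, j, hj0, hjp, hTj⟩ :=
    sum_pow_eq_zero_and_exists_pow_of_commute hp T τ hcomm hτp hfix W hrange hsum hdim hW0
  -- the inverse `k` of `j` modulo `p`
  have hjz : ((j : ℕ) : ZMod p) ≠ 0 := by
    rw [Ne, ZMod.natCast_eq_zero_iff]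
    exact fun h => absurd (Nat.le_of_dvd hj0 h) (not_le.mpr hjp)
  set k : ℕ := ((j : ZMod p)⁻¹).val with hk
  have hjk : j * k % p = 1 := by
    have h1 : ((j * k : ℕ) : ZMod p) = ((1 : ℕ) : ZMod p) := by
      rw [Nat.cast_mul, hk, ZMod.natCast_zmod_val, mul_inv_cancel₀ hjz, Nat.cast_one]
    rw [(ZMod.natCast_eq_natCast_iff' _ _ _).mp h1, Nat.mod_eq_of_lt hp.one_lt]
  -- powers of `T` on `W` are powers of `τ`
  have hτiW : ∀ (i : ℕ), ∀ w ∈ W, (τ ^ i) w ∈ W := by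
    intro i
    induction i with
    | zero => intro w hw; rwa [pow_zero, linearEquiv_one_apply]
    | succ i ih => intro w hw; rw [pow_succ', LinearEquiv.mul_apply]; exact hτW _ (ih w hw)
  have hTn : ∀ (n : ℕ), ∀ w ∈ W, (T ^ n) w = (τ ^ (j * n)) w := by
    intro n
    induction n with
    | zero => intro w _; rw [mul_zero, pow_zero, pow_zero]
    | succ n ih =>
      intro w hw
      rw [pow_succ, LinearEquiv.mul_apply, hTj w hw, ih _ (hτiW j w hw), ← LinearEquiv.mul_apply, ← pow_add,
        mul_add_one]
  have hτpow : ∀ (m : ℕ) (x : V), (τ ^ (p * m)) x = x := fun m x => by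
    rw [pow_mul, hτp, one_pow, linearEquiv_one_apply]
  have hrτ : ∀ w ∈ W, (T ^ k) w = τ w := fun w hw => by
    rw [hTn k w hw, ← Nat.div_add_mod (j * k) p, hjk, pow_add, pow_one, LinearEquiv.mul_apply, hτpow]
  have hrk : ∀ x, (T ^ k) x - x ∈ W := pow_apply_sub_mem_of_sub_mem T W hrange k
  have hriso : ∀ x y, B ((T ^ k) x) ((T ^ k) y) = B x y := isometry_pow T hT k
  obtain ⟨δ, hδ0, hδsum, hfr, hnd, hrefl⟩ :=
    exists_cyclicReflection_data_of_localisation hp B hB (T ^ k) τ hriso W hrk hrτ hsumτ hdim hW0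
  -- `ℚ[τ]δ = W = (T − 1)V`
  have hCle : cyclicSpan τ δ ≤ W := by
    rw [← range_sub_id_eq_cyclicSpan hBs hp0 hδsum hnd hrefl]
    rintro _ ⟨x, rfl⟩
    exact hrk x
  have hCW : cyclicSpan τ δ = W := Submodule.eq_of_le_of_finrank_le hCle (by rw [hfr]; exact hdim)
  have hRW : LinearMap.range ((T : V →ₗ[ℚ] V) - LinearMap.id) = W := by
    refine le_antisymm ?_ fun w hw => ?_
    · rintro _ ⟨x, rfl⟩
      exact hrange x
    · obtain ⟨x, hx⟩ := hrangeW w hw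
      exact ⟨x, hx⟩
  -- `T^p = 1`: `T = τ^j` on `W` and `T = id` on `W^⊥`
  have hndW : ∀ x ∈ W, (∀ y ∈ W, B x y = 0) → x = 0 := by rw [← hCW]; exact hnd
  have hBsymm : ∀ u v : V, B u v = B v u := fun u v => by simpa using hBs.eq u v
  have hTp : T ^ p = 1 := by
    have hcompl := isCompl_cyclicSpan_orthogonal (τ := τ) (δ := δ) hBs hnd
    rw [hCW] at hcompl
    refine LinearEquiv.ext fun x => ?_
    obtain ⟨a, ha, b, hb, rfl⟩ := Submodule.mem_sup.mp
      (show x ∈ W ⊔ B.orthogonal W by rw [hcompl.sup_eq_top]; trivial)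
    rw [LinearMap.BilinForm.mem_orthogonal_iff] at hb
    have hTb : T b = b :=
      apply_eq_self_of_orthogonal B T hT W hrange hndW fun v hv => by rw [hBsymm]; exact hb v hv
    have hTpb : ∀ n : ℕ, (T ^ n) b = b := fun n => by
      induction n with
      | zero => rw [pow_zero, linearEquiv_one_apply]
      | succ n ih => rw [pow_succ, LinearEquiv.mul_apply, hTb, ih]
    rw [map_add, linearEquiv_one_apply, hTn p a ha, mul_comm j p, hτpow, hTpb]
  have hTmem : T ∈ Subgroup.zpowers (T ^ k) := by
    have h : (T ^ k) ^ j = T := by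
      rw [← pow_mul, mul_comm, ← Nat.div_add_mod (j * k) p, hjk, pow_add, pow_one, pow_mul, hTp, one_pow,
        one_mul]
    have hm : (T ^ k) ^ j ∈ Subgroup.zpowers (T ^ k) := Subgroup.npow_mem_zpowers _ _
    rwa [h] at hm
  exact ⟨k, δ, hδ0, hδsum, hfr, hnd, hrefl, hTmem, hCW, hRW⟩

end Algebra

end Literature.AlgebraicGeometry.HodgeTheory

end
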